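import Literature.Geometry.Lorentzian.AdiabaticTracking
import Summits.FinalStateConjecture.FinalStateConjecture.Statement
import HarnessLib

/-!
# FREEZE fragments for crux `DriftCapture` (stmt-FinalStateConjecture-17391), line `birth`

The registered stub `stub_parametersFreeze` (FREEZE) of the skeleton
`Summits/FinalStateConjecture/FinalStateConjecture/Cruxes/DriftCapture/Lines/birth.lean` says: for every
complexity `(N, m₀, χ)`, `0 < m₀`, `0 ≤ χ < 1`, a maximal vacuum Cauchy development of an admissible datum
with complete `𝓘⁺` which is adiabatically tracked at EVERY accuracy
(`VacuumCauchyDevelopment.IsAdiabaticallyTracked`) is tracked at every accuracy by chains all of whose window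
labels are `δ`-close, for every `δ > 0`, to ONE point `(M, a, Λ)` of the moduli space.

This file lands the parts of FREEZE that hold by bookkeeping alone and isolates its live range:

* `parametersFreeze_zero` — the `N = 0` instance (no label to pin: the tracked chain is pinned at the
  empty label);
* `not_isAdiabaticallyTracked_of_one_lt` — for `N ≥ 1` and `1 < m₀` the tracking seam is unsatisfiable
  (a hole would have mass `m₀ ≤ M ≤ m₀⁻¹ < m₀`), so
* `parametersFreeze_of_one_lt` — FREEZE holds vacuously on `N ≥ 1 ∧ 1 < m₀`;
* `parametersFreeze_of_live` — FREEZE follows from its restriction to the LIVE RANGE `N ≥ 1`, `m₀ ≤ 1`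
  (where it is the route's renormalised-drift engine: label convergence under all-accuracy, unweighted `C²`
  tracking, budgeted by the first law; open).

No definitions are introduced and no named facts are used.

References: Klainerman, C. R. Mécanique 353 (2025), §2.3 (asymptotic orbital stability); DHRT
arXiv:2104.08222, §1 (the `Cᵏ`-deviation vocabulary).
-/

-- the doubled `FinalStateConjecture.FinalStateConjecture` path component trips dupNamespace
set_option linter.dupNamespace false

noncomputable section

namespace Summit.FinalStateConjecture.FinalStateConjecture.Theorems.RenormalisedDrift.DriftCapture

open Set Filter Topology
open scoped Manifold ContDiff ENNReal
open Literature.Geometry.Lorentzian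

/-- **Degenerate range of the tracking seam.** With at least one hole and mass floor `m₀ > 1` no
development is adiabatically tracked: a tracked chain's first configuration has a hole of mass
`m₀ ≤ M ≤ m₀⁻¹`, impossible since `m₀⁻¹ < m₀`. [folklore] -/
theorem not_isAdiabaticallyTracked_of_one_lt {X : Type} [TopologicalSpace X] [ChartedSpace E3 X]
    [IsManifold (𝓡 3) ∞ X] [ConnectedSpace X] {D : InitialDataSet (𝓡 3) X}
    (𝒟 : VacuumCauchyDevelopment D) {N : ℕ} {m₀ χ : ℝ} {ε : ℝ≥0∞} {L R₀ : ℝ} (hN : 0 < N)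
    (hm₀ : 1 < m₀) : ¬ 𝒟.IsAdiabaticallyTracked N m₀ χ ε L R₀ := by
  rintro ⟨R, O, c, -, -, hcN, hM, -⟩
  obtain ⟨h₁, h₂, -⟩ := hM 0 ⟨0, (hcN 0).symm ▸ hN⟩
  have h : m₀ ≤ m₀⁻¹ := h₁.trans h₂
  have h' : m₀⁻¹ < m₀ := by
    calc m₀⁻¹ < 1 := inv_lt_one_of_one_lt₀ hm₀
      _ < m₀ := hm₀
  exact absurd h (not_le.2 h')

/-- **FREEZE, `N = 0` (dispersal complexity).** With no hole there is no label to freeze: every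
tracked chain is pinned at the empty label, so the `N = 0` instance of the registered stub
`stub_parametersFreeze` holds outright. Klainerman, C. R. Mécanique 353 (2025), §2.3. [folklore] -/
theorem parametersFreeze_zero : ∀ (m₀ χ : ℝ), 0 < m₀ → 0 ≤ χ → χ < 1 → ∀ (X : Type) [TopologicalSpace X] [ChartedSpace E3 X] [IsManifold (𝓡 3) ((⊤ : ℕ∞) : WithTop ℕ∞) X] [T2Space X] [SecondCountableTopology X] [ConnectedSpace X], ∀ D ∈ admissibleVacuumData X, ∀ 𝒟 : VacuumCauchyDevelopment D, 𝒟.IsMaximal → Summit.FinalStateConjecture.HasCompleteNullInfinity 𝒟.toCauchyDevelopment → (∀ (L : ℝ) (ε : ENNReal) (R₀ : ℝ), 0 < L → 0 < ε → 𝒟.IsAdiabaticallyTracked 0 m₀ χ ε L R₀) → ∃ (M a : Fin 0 → ℝ) (Λ : Fin 0 → lorentzGroup), (∀ j, m₀ ≤ M j ∧ M j ≤ m₀⁻¹ ∧ |a j| ≤ χ * M j) ∧ ∀ δ : ℝ, 0 < δ → ∀ (L : ℝ) (ε : ENNReal) (R₀ : ℝ), 0 < L → 0 < ε → ∃ (R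 : ℕ → ℝ) (O : Set 𝒟.carrier) (c : ∀ n : ℕ, ApproximateKerrConfiguration 𝒟.toSpacetime O 2 ε 0 L (R n)), (∀ n, R₀ ≤ R n) ∧ Tendsto R atTop atTop ∧ (∀ n, (c n).N = 0) ∧ (∀ n (i : Fin (c n).N), m₀ ≤ (c n).mass i ∧ (c n).mass i ≤ m₀⁻¹ ∧ |(c n).spin i| ≤ χ * (c n).mass i) ∧ (∀ n (i : Fin (c n).N) (j : Fin 0), (i : ℕ) = (j : ℕ) → |(c n).mass i - M j| ≤ δ ∧ |(c n).spin i - a j| ≤ δ ∧ ‖((((c n).motion i).1 : E4 ≃L[ℝ] E4) : E4 →L[ℝ] E4) - (((Λ j : E4 ≃L[ℝ] E4)) : E4 →L[ℝ] E4)‖ ≤ δ) ∧ (∀ n, (c (n + 1)).certifiedSlab 0 ⊆ (c n).windowImage) ∧ (∀ K : Set 𝒟.carrier, IsCompact K → ∃ n₀ : ℕ, ∀ n, n₀ ≤ n → Disjoint (c n).windowImage (𝒟.metric.causalPast 𝒟.timeOrientation K)) ∧ O = 𝒟.toCauchyDevelopment.exteriorOf (⋃ n, (c n).windowImage) ∧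 O ⊆ 𝒟.metric.causalPast 𝒟.timeOrientation ((c 0).certifiedSlab 0) ∪ ⋃ n, (c n).windowImage := by
  intro m₀ χ _ _ _ X _ _ _ _ _ _ D _ 𝒟 _ _ h
  refine ⟨Fin.elim0, Fin.elim0, Fin.elim0, fun j ↦ j.elim0, fun δ _ L ε R₀ hL hε ↦ ?_⟩
  obtain ⟨R, O, c, hR, hRt, hN, hM, hch, hex, hO, hcov⟩ := h L ε R₀ hL hε
  exact ⟨R, O, c, hR, hRt, hN, hM, fun n i j _ ↦ j.elim0, hch, hex, hO, hcov⟩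

/-- **FREEZE, degenerate range `N ≥ 1`, `1 < m₀`.** The all-accuracy tracking hypothesis is
unsatisfiable (`not_isAdiabaticallyTracked_of_one_lt`, at any one accuracy, e.g. `L = ε = 1`), so
this instance of the registered stub `stub_parametersFreeze` holds vacuously. [folklore] -/
theorem parametersFreeze_of_one_lt : ∀ (N : ℕ) (m₀ χ : ℝ), 0 < N → 1 < m₀ → 0 < m₀ → 0 ≤ χ → χ < 1 → ∀ (X : Type) [TopologicalSpace X] [ChartedSpace E3 X] [IsManifold (𝓡 3) ((⊤ : ℕ∞) : WithTop ℕ∞) X] [T2Space X] [SecondCountableTopology X] [ConnectedSpace X], ∀ D ∈ admissibleVacuumData X, ∀ 𝒟 : VacuumCauchyDevelopment D, 𝒟.IsMaximal → Summit.FinalStateConjecture.HasCompleteNullInfinity 𝒟.toCauchyDevelopment → (∀ (L : ℝ) (ε : ENNReal) (R₀ : ℝ), 0 < L → 0 < ε → 𝒟.IsAdiabaticallyTracked N m₀ χ ε L R₀) → ∃ (M a : Fin N → ℝ) (Λ : Fin N → lorentzGroup), (∀ j, m₀ ≤ M j ∧ M j ≤ m₀⁻¹ ∧ |a j| ≤ χ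 * M j) ∧ ∀ δ : ℝ, 0 < δ → ∀ (L : ℝ) (ε : ENNReal) (R₀ : ℝ), 0 < L → 0 < ε → ∃ (R : ℕ → ℝ) (O : Set 𝒟.carrier) (c : ∀ n : ℕ, ApproximateKerrConfiguration 𝒟.toSpacetime O 2 ε 0 L (R n)), (∀ n, R₀ ≤ R n) ∧ Tendsto R atTop atTop ∧ (∀ n, (c n).N = N) ∧ (∀ n (i : Fin (c n).N), m₀ ≤ (c n).mass i ∧ (c n).mass i ≤ m₀⁻¹ ∧ |(c n).spin i| ≤ χ * (c n).mass i) ∧ (∀ n (i : Fin (c n).N) (j : Fin N), (i : ℕ) = (j : ℕ) → |(c n).mass i - M j| ≤ δ ∧ |(c n).spin i - a j| ≤ δ ∧ ‖((((c n).motion i).1 : E4 ≃L[ℝ] E4) : E4 →L[ℝ] E4) - (((Λ j : E4 ≃L[ℝ] E4)) : E4 →L[ℝ] E4)‖ ≤ δ) ∧ (∀ n, (c (n + 1)).certifiedSlab 0 ⊆ (c n).windowImage) ∧ (∀ K : Set 𝒟.carrier, IsCompact K → ∃ n₀ : ℕ, ∀ n, n₀ ≤ n → Disjoint (c n).windowImage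 (𝒟.metric.causalPast 𝒟.timeOrientation K)) ∧ O = 𝒟.toCauchyDevelopment.exteriorOf (⋃ n, (c n).windowImage) ∧ O ⊆ 𝒟.metric.causalPast 𝒟.timeOrientation ((c 0).certifiedSlab 0) ∪ ⋃ n, (c n).windowImage := by
  intro N m₀ χ hN hm₀ _ _ _ X _ _ _ _ _ _ D _ 𝒟 _ _ h
  exact absurd (h 1 1 0 one_pos one_pos) (not_isAdiabaticallyTracked_of_one_lt 𝒟 hN hm₀)

/-- **Live-range reduction for FREEZE.** The registered stub `stub_parametersFreeze` (all `N`, all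
`m₀ > 0`) follows from its restriction to the live range `N ≥ 1`, `m₀ ≤ 1`: the case `N = 0` is
`parametersFreeze_zero` and the case `1 < m₀` is `parametersFreeze_of_one_lt`. [folklore] -/
theorem parametersFreeze_of_live
    (hlive : ∀ (N : ℕ) (m₀ χ : ℝ), 0 < N → m₀ ≤ 1 → 0 < m₀ → 0 ≤ χ → χ < 1 → ∀ (X : Type) [TopologicalSpace X] [ChartedSpace E3 X] [IsManifold (𝓡 3) ((⊤ : ℕ∞) : WithTop ℕ∞) X] [T2Space X] [SecondCountableTopology X] [ConnectedSpace X], ∀ D ∈ admissibleVacuumData X, ∀ 𝒟 : VacuumCauchyDevelopment D, 𝒟.IsMaximal → Summit.FinalStateConjecture.HasCompleteNullInfinity 𝒟.toCauchyDevelopment → (∀ (L : ℝ) (ε : ENNReal) (R₀ : ℝ), 0 < L → 0 < ε → 𝒟.IsAdiabaticallyTracked N m₀ χ ε L R₀) → ∃ (M a : Fin N → ℝ) (Λ : Fin N → lorentzGroup), (∀ j, m₀ ≤ M j ∧ M j ≤ m₀⁻¹ ∧ |a j| ≤ χ * M j) ∧ ∀ δ : ℝ, 0 < δ → ∀ (L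 : ℝ) (ε : ENNReal) (R₀ : ℝ), 0 < L → 0 < ε → ∃ (R : ℕ → ℝ) (O : Set 𝒟.carrier) (c : ∀ n : ℕ, ApproximateKerrConfiguration 𝒟.toSpacetime O 2 ε 0 L (R n)), (∀ n, R₀ ≤ R n) ∧ Tendsto R atTop atTop ∧ (∀ n, (c n).N = N) ∧ (∀ n (i : Fin (c n).N), m₀ ≤ (c n).mass i ∧ (c n).mass i ≤ m₀⁻¹ ∧ |(c n).spin i| ≤ χ * (c n).mass i) ∧ (∀ n (i : Fin (c n).N) (j : Fin N), (i : ℕ) = (j : ℕ) → |(c n).mass i - M j| ≤ δ ∧ |(c n).spin i - a j| ≤ δ ∧ ‖((((c n).motion i).1 : E4 ≃L[ℝ] E4) : E4 →L[ℝ] E4) - (((Λ j : E4 ≃L[ℝ] E4)) : E4 →L[ℝ] E4)‖ ≤ δ) ∧ (∀ n, (c (n + 1)).certifiedSlab 0 ⊆ (c n).windowImage) ∧ (∀ K : Set 𝒟.carrier, IsCompact K → ∃ n₀ : ℕ, ∀ n, n₀ ≤ n → Disjoint (c n).windowImage (𝒟.metric.causalPast 𝒟.timeOrientation K)) ∧ O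 = 𝒟.toCauchyDevelopment.exteriorOf (⋃ n, (c n).windowImage) ∧ O ⊆ 𝒟.metric.causalPast 𝒟.timeOrientation ((c 0).certifiedSlab 0) ∪ ⋃ n, (c n).windowImage) :
    ∀ (N : ℕ) (m₀ χ : ℝ), 0 < m₀ → 0 ≤ χ → χ < 1 → ∀ (X : Type) [TopologicalSpace X] [ChartedSpace E3 X] [IsManifold (𝓡 3) ((⊤ : ℕ∞) : WithTop ℕ∞) X] [T2Space X] [SecondCountableTopology X] [ConnectedSpace X], ∀ D ∈ admissibleVacuumData X, ∀ 𝒟 : VacuumCauchyDevelopment D, 𝒟.IsMaximal → Summit.FinalStateConjecture.HasCompleteNullInfinity 𝒟.toCauchyDevelopment → (∀ (L : ℝ) (ε : ENNReal) (R₀ : ℝ), 0 < L → 0 < ε → 𝒟.IsAdiabaticallyTracked N m₀ χ ε L R₀) → ∃ (M a : Fin N → ℝ) (Λ : Fin N → lorentzGroup), (∀ j, m₀ ≤ M j ∧ M j ≤ m₀⁻¹ ∧ |a j| ≤ χ * M j) ∧ ∀ δ : ℝ, 0 < δ → ∀ (L : ℝ) (ε : ENNReal) (R₀ : ℝ), 0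 < L → 0 < ε → ∃ (R : ℕ → ℝ) (O : Set 𝒟.carrier) (c : ∀ n : ℕ, ApproximateKerrConfiguration 𝒟.toSpacetime O 2 ε 0 L (R n)), (∀ n, R₀ ≤ R n) ∧ Tendsto R atTop atTop ∧ (∀ n, (c n).N = N) ∧ (∀ n (i : Fin (c n).N), m₀ ≤ (c n).mass i ∧ (c n).mass i ≤ m₀⁻¹ ∧ |(c n).spin i| ≤ χ * (c n).mass i) ∧ (∀ n (i : Fin (c n).N) (j : Fin N), (i : ℕ) = (j : ℕ) → |(c n).mass i - M j| ≤ δ ∧ |(c n).spin i - a j| ≤ δ ∧ ‖((((c n).motion i).1 : E4 ≃L[ℝ] E4) : E4 →L[ℝ] E4) - (((Λ j : E4 ≃L[ℝ] E4)) : E4 →L[ℝ] E4)‖ ≤ δ) ∧ (∀ n, (c (n + 1)).certifiedSlab 0 ⊆ (c n).windowImage) ∧ (∀ K : Set 𝒟.carrier, IsCompact K → ∃ n₀ : ℕ, ∀ n, n₀ ≤ n → Disjoint (c n).windowImage (𝒟.metric.causalPast 𝒟.timeOrientation K)) ∧ O = 𝒟.toCauchyDevelopment.exteriorOf (⋃ n,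 (c n).windowImage) ∧ O ⊆ 𝒟.metric.causalPast 𝒟.timeOrientation ((c 0).certifiedSlab 0) ∪ ⋃ n, (c n).windowImage := by
  intro N m₀ χ hm₀ hχ₀ hχ₁ X _ _ _ _ _ _ D hD 𝒟 hmax hscri h
  rcases Nat.eq_zero_or_pos N with rfl | hN
  · exact parametersFreeze_zero m₀ χ hm₀ hχ₀ hχ₁ X D hD 𝒟 hmax hscri h
  · rcases le_or_gt m₀ 1 with hle | hlt
    · exact hlive N m₀ χ hN hle hm₀ hχ₀ hχ₁ X D hD 𝒟 hmax hscri h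
    · exact parametersFreeze_of_one_lt N m₀ χ hN hlt hm₀ hχ₀ hχ₁ X D hD 𝒟 hmax hscri h

end Summit.FinalStateConjecture.FinalStateConjecture.Theorems.RenormalisedDrift.DriftCapture

end
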